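import Summits.KontsevichZagierPeriods.KontsevichZagierPeriods.Theses.HurwitzMicroSectors
import Summits.KontsevichZagierPeriods.KontsevichZagierPeriods.Theorems.HurwitzMicroSectorsNormalFormPrinciplePiBoxTransfer
import Summits.KontsevichZagierPeriods.KontsevichZagierPeriods.Theorems.HurwitzMicroSectorsNormalFormPrincipleVariants2204
import Summits.KontsevichZagierPeriods.KontsevichZagierPeriods.Theorems.HurwitzMicroSectorsNormalFormPrincipleVariants2209
import Summits.KontsevichZagierPeriods.KontsevichZagierPeriods.Theorems.HurwitzMicroSectorsNormalFormPrincipleVariants2238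
import Summits.KontsevichZagierPeriods.KontsevichZagierPeriods.Theorems.HurwitzMicroSectorsNormalFormPrincipleVariants2340

/-! TTRL-lite variant V2210 of stmt-KontsevichZagierPeriods-3869

Variant V2210 = `stub_boxRigidity` (BoxRigidity: two representations on open unit boxes with
integrands of KZ's rational shape and equal values are KZ-equivalent) under the JOINT move
`fix_nat:m=2; bound_nat:m'≤3` (left dimension frozen to `2`, right dimension at most `3`). Verdict of
the attempt seat: **open** — this file is the exact-strength certificate, not a proof of the variant.
Write `BoxVanishing D` for "every box-rational representation of dimension `D` and value `0` is a
relation" (Conjecture 1, kernel form, for absolutely convergent `∫_{(0,1)^D} p/q`, `p, q ∈ ℚ[x]`).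
* `stub_boxRigidity_var2210_iff_boxVanishing_three`: **V2210 ⟺ BoxVanishing 3** (pair `(2,3)` against
  the zero representation; conversely pad to the cube and subtract, `pad_le`/`sub_same`, tree), hence
  `⟺ BoxRigidity for all m, m' ≤ 3` (`…_iff_le_three`) and `⟺` the mirrored sibling V2238
  (`fix m=3; m'≤2`, `…_iff_var2238`); it implies the level-2 sibling V2204 (`…var2204_of_var2210`) and
  with it Conjecture 1 on every weight-two Hurwitz sector of the square, Catalan rung included, with no
  independence input (`catalanSector_unconditional_of_stub_boxRigidity_var2210`, through file
  `…Variants2204`); it is also `⟺` the doubly-frozen sibling V2209 (`fix m=2; fix m'=3`,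
  `…_iff_var2209`): inside a joint move the bound `m' ≤ 3` is worth exactly the single pair `(2,3)`.
* The law of the MIXED programmatic moves of this stub, with no side condition (new here as theorems):
  `fix m=m₀; bound m'≤k ⟺ BoxVanishing (max m₀ k)` (`boxRigidityFixLe_iff_boxVanishingDim`) and
  `bound m≤j; fix m'=m₀ ⟺ BoxVanishing (max j m₀)` (`boxRigidityLeFix_iff_boxVanishingDim`). With
  `fix/fix ⟺ BoxVanishing (max a b)` (`boxRigidityAt_iff_boxVanishing`, file `…Variants2209`),
  `bound/bound ⟺ BoxVanishing (max j k)` (`boxRigidityLe_iff_boxVanishing`, file `…Variants2239`) and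
  "one side free ⟺ the whole leaf" (`boxRigidityLeft/Right(_Le)_iff`, files `…Variants2200/2256`),
  EVERY dimension variant of the stub is either the parent or `BoxVanishing D`, a chain antitone in `D`
  (`boxVanishingDim_mono`, file `…Variants2238`) whose level `D ≤ 1` is a THEOREM (`boxVanishingLe_one`,
  file `…Variants2340`, from `boxRigidity_of_le_one`, Baker; here `boxRigidityFixLe_of_max_le_one`)
  and whose level `2` is already open
  (all `ℚ`-linear relations among `G`, `ζ(2)`, `π log α`, `log α log β`, `Li₂` box integrals must be
  move-derivable; the tree has instances only: `catalanTwoWays`, `FiveZetaTwo`, the cyclotomic layer).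
  V2210 is level `3` (`ζ(3) = ∫∫∫ dxdydz/(1−xyz)` against `π³/64 = ∫∫∫ ∏ dxᵢ/(1+xᵢ²)`).
* `stub_boxRigidity_var2210_of_statement`: `KontsevichZagierPeriods → parent → V2210`, and the tree's
  only invariant of `KZ.relations` is `eval`, so a refutation would refute the Summit.
Source: M. Kontsevich, D. Zagier, *Periods* (2001), §1.2 Conjecture 1; A. Baker, *Transcendental
Number Theory* (1975), Thm. 2.1 (level `≤ 1`). Pure proof file, no definitions. -/

-- `Summit.<Summit>.<Problem>` is the tree's mandated summit-side namespace (CONVENTIONS §2); for this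
-- single-conjunct summit the two coincide, so the duplicate is deliberate.
set_option linter.dupNamespace false

noncomputable section

namespace Summit.KontsevichZagierPeriods.KontsevichZagierPeriods.Theorems

open MeasureTheory Set
open Literature.NumberTheory.Transcendental Literature.NumberTheory.Transcendental.KZ
open Summit.KontsevichZagierPeriods.KontsevichZagierPeriods.Theses.HurwitzMicroSectors
open Summit.KontsevichZagierPeriods.HurwitzMicroSectors.NormalFormPrinciple.PiBox

/-! ## The law of the programmatic dimension moves: everything is `BoxVanishing (max …)` -/

/-- **`fix m := m₀; bound m' ≤ k ⟺ BoxVanishing (max m₀ k)`.** (⇒) the pair `(m₀, k)` is allowed,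
giving `BoxVanishing` of both `m₀` and `k` (`boxVanishingDim_left/right_of_pair`), and `BoxVanishing`
descends from the larger one to `max m₀ k` (`boxVanishingDim_mono`); (⇐) `boxRigidityLe_of_boxVanishingDim`.
[cite: KontsevichZagier2001, §1.2 Conjecture 1] -/
theorem boxRigidityFixLe_iff_boxVanishingDim (m₀ k : ℕ) :
    (∀ (m' : ℕ) (N : IntegralRep m₀) (N' : IntegralRep m'), m' ≤ k →
      N.domain = {x | ∀ i, x i ∈ Set.Ioo (0:ℝ) 1} → N.IsRational →
      N'.domain = {x | ∀ i, x i ∈ Set.Ioo (0:ℝ) 1} → N'.IsRational →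
      N.value = N'.value → Equivalent N N') ↔
    (∀ N : IntegralRep (max m₀ k), N.domain = {x | ∀ i, x i ∈ Set.Ioo (0:ℝ) 1} → N.IsRational →
      N.value = 0 → of N ∈ relations) := by
  refine ⟨fun h N hNd hNr hv => ?_, fun h m' N N' hm' =>
    boxRigidityLe_of_boxVanishingDim (max m₀ k) h m₀ m' N N' (le_max_left _ _)
      (hm'.trans (le_max_right _ _))⟩
  rcases le_total m₀ k with hle | hle
  · exact boxVanishingDim_mono (max_le hle le_rfl)
      (boxVanishingDim_right_of_pair m₀ k fun M M' => h k M M' le_rfl) N hNd hNr hv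
  · exact boxVanishingDim_mono (max_le le_rfl hle)
      (boxVanishingDim_left_of_pair m₀ k fun M M' => h k M M' le_rfl) N hNd hNr hv

/-- **`bound m ≤ j; fix m' := m₀ ⟺ BoxVanishing (max j m₀)`** (the mirrored law).
[cite: KontsevichZagier2001, §1.2 Conjecture 1] -/
theorem boxRigidityLeFix_iff_boxVanishingDim (j m₀ : ℕ) :
    (∀ (m : ℕ) (N : IntegralRep m) (N' : IntegralRep m₀), m ≤ j →
      N.domain = {x | ∀ i, x i ∈ Set.Ioo (0:ℝ) 1} → N.IsRational →
      N'.domain = {x | ∀ i, x i ∈ Set.Ioo (0:ℝ) 1} → N'.IsRational →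
      N.value = N'.value → Equivalent N N') ↔
    (∀ N : IntegralRep (max j m₀), N.domain = {x | ∀ i, x i ∈ Set.Ioo (0:ℝ) 1} → N.IsRational →
      N.value = 0 → of N ∈ relations) := by
  refine ⟨fun h N hNd hNr hv => ?_, fun h m N N' hm =>
    boxRigidityLe_of_boxVanishingDim (max j m₀) h m m₀ N N' (hm.trans (le_max_left _ _))
      (le_max_right _ _)⟩
  rcases le_total j m₀ with hle | hle
  · exact boxVanishingDim_mono (max_le hle le_rfl)
      (boxVanishingDim_right_of_pair j m₀ fun M M' => h j M M' le_rfl) N hNd hNr hv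
  · exact boxVanishingDim_mono (max_le le_rfl hle)
      (boxVanishingDim_left_of_pair j m₀ fun M M' => h j M M' le_rfl) N hNd hNr hv

/-- **Every level `≤ 1` instance of the mixed law is a theorem**: the joint move
`fix m := m₀; bound m' ≤ k` with `max m₀ k ≤ 1` holds (`boxVanishingLe_one`, file `…Variants2340`, from
`boxRigidity_of_le_one` — Baker's theorem on linear forms in logarithms). [cite: KontsevichZagier2001, §1.2 Conjecture 1] -/
theorem boxRigidityFixLe_of_max_le_one {m₀ k : ℕ} (h : max m₀ k ≤ 1) :
    ∀ (m' : ℕ) (N : IntegralRep m₀) (N' : IntegralRep m'), m' ≤ k →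
      N.domain = {x | ∀ i, x i ∈ Set.Ioo (0:ℝ) 1} → N.IsRational →
      N'.domain = {x | ∀ i, x i ∈ Set.Ioo (0:ℝ) 1} → N'.IsRational →
      N.value = N'.value → Equivalent N N' :=
  (boxRigidityFixLe_iff_boxVanishingDim m₀ k).2 fun N => boxVanishingLe_one (max m₀ k) N h

/-! ## The variant V2210 itself: exactly `BoxVanishing 3` -/

/-- **V2210 ⟺ BoxVanishing 3**: the variant is exactly Conjecture 1 (kernel form) for absolutely
convergent integrals `∫_{(0,1)³} p/q`, `p, q ∈ ℚ[x,y,z]`, `q ≠ 0` on the open cube (the instance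
`m₀ = 2, k = 3` of `boxRigidityFixLe_iff_boxVanishingDim`). [cite: KontsevichZagier2001, §1.2 Conjecture 1] -/
theorem stub_boxRigidity_var2210_iff_boxVanishing_three :
    (∀ (m' : ℕ) (N : IntegralRep 2) (N' : IntegralRep m'), m' ≤ 3 → N.domain = {x | ∀ i, x i ∈ Set.Ioo (0:ℝ) 1} → N.IsRational → N'.domain = {x | ∀ i, x i ∈ Set.Ioo (0:ℝ) 1} → N'.IsRational → N.value = N'.value → Equivalent N N') ↔
    (∀ N : IntegralRep 3, N.domain = {x | ∀ i, x i ∈ Set.Ioo (0:ℝ) 1} → N.IsRational →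
      N.value = 0 → of N ∈ relations) :=
  ⟨fun h => boxVanishingDim_right_of_pair 2 3 fun N N' => h 3 N N' le_rfl,
    fun h m' N N' hm' => boxRigidityLe_of_boxVanishingDim 3 h 2 m' N N' (by norm_num) hm'⟩

/-- **V2210 ⟺ BoxRigidity for all pairs of dimensions `≤ 3`** (the bound `m' ≤ 3` absorbs the frozen
`m = 2`: the variant is the symmetric small case `m, m' ≤ 3` of the leaf).
[cite: KontsevichZagier2001, §1.2 Conjecture 1] -/
theorem stub_boxRigidity_var2210_iff_le_three :
    (∀ (m' : ℕ) (N : IntegralRep 2) (N' : IntegralRep m'), m' ≤ 3 → N.domain = {x | ∀ i, x i ∈ Set.Ioo (0:ℝ) 1} → N.IsRational → N'.domain = {x | ∀ i, x i ∈ Set.Ioo (0:ℝ) 1} → N'.IsRational → N.value = N'.value → Equivalent N N') ↔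
    (∀ (m m' : ℕ) (N : IntegralRep m) (N' : IntegralRep m'), m ≤ 3 → m' ≤ 3 →
      N.domain = {x | ∀ i, x i ∈ Set.Ioo (0:ℝ) 1} → N.IsRational →
      N'.domain = {x | ∀ i, x i ∈ Set.Ioo (0:ℝ) 1} → N'.IsRational →
      N.value = N'.value → Equivalent N N') :=
  ⟨fun h => boxRigidityLe_of_boxVanishingDim 3 (stub_boxRigidity_var2210_iff_boxVanishing_three.1 h),
    fun h m' N N' hm' => h 2 m' N N' (by norm_num) hm'⟩

/-- **V2210 ⟺ V2238** (`fix m = 3; m' ≤ 2`): mirrored joint moves with the same maximal dimension are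
the same statement. [cite: KontsevichZagier2001, §1.2 Conjecture 1] -/
theorem stub_boxRigidity_var2210_iff_var2238 :
    (∀ (m' : ℕ) (N : IntegralRep 2) (N' : IntegralRep m'), m' ≤ 3 → N.domain = {x | ∀ i, x i ∈ Set.Ioo (0:ℝ) 1} → N.IsRational → N'.domain = {x | ∀ i, x i ∈ Set.Ioo (0:ℝ) 1} → N'.IsRational → N.value = N'.value → Equivalent N N') ↔
    (∀ (m' : ℕ) (N : IntegralRep 3) (N' : IntegralRep m'), m' ≤ 2 → N.domain = {x | ∀ i, x i ∈ Set.Ioo (0:ℝ) 1} → N.IsRational → N'.domain = {x | ∀ i, x i ∈ Set.Ioo (0:ℝ) 1} → N'.IsRational → N.value = N'.value → Equivalent N N') :=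
  stub_boxRigidity_var2210_iff_boxVanishing_three.trans stub_boxRigidity_var2238_iff_boxVanishing_three.symm

/-- **V2210 ⟺ V2209** (`fix m = 2; fix m' = 3`): inside the joint move the bound `m' ≤ 3` is worth
exactly the single pair of dimensions `(2, 3)` (`boxRigidityAt_iff_boxVanishing`, file `…Variants2209`).
[cite: KontsevichZagier2001, §1.2 Conjecture 1] -/
theorem stub_boxRigidity_var2210_iff_var2209 :
    (∀ (m' : ℕ) (N : IntegralRep 2) (N' : IntegralRep m'), m' ≤ 3 → N.domain = {x | ∀ i, x i ∈ Set.Ioo (0:ℝ) 1} → N.IsRational → N'.domain = {x | ∀ i, x i ∈ Set.Ioo (0:ℝ) 1} → N'.IsRational → N.value = N'.value → Equivalent N N') ↔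
    (∀ (N : IntegralRep 2) (N' : IntegralRep 3), N.domain = {x | ∀ i, x i ∈ Set.Ioo (0:ℝ) 1} → N.IsRational → N'.domain = {x | ∀ i, x i ∈ Set.Ioo (0:ℝ) 1} → N'.IsRational → N.value = N'.value → Equivalent N N') :=
  stub_boxRigidity_var2210_iff_boxVanishing_three.trans stub_boxRigidity_var2209_iff_boxVanishing_three.symm

/-- **V2210 ⇒ BoxVanishing in every dimension `≤ 3`.** [cite: KontsevichZagier2001, §1.2 Conjecture 1] -/
theorem boxVanishing_le_three_of_stub_boxRigidity_var2210
    (h : ∀ (m' : ℕ) (N : IntegralRep 2) (N' : IntegralRep m'), m' ≤ 3 → N.domain = {x | ∀ i, x i ∈ Set.Ioo (0:ℝ) 1} → N.IsRational → N'.domain = {x | ∀ i, x i ∈ Set.Ioo (0:ℝ) 1} → N'.IsRational → N.value = N'.value → Equivalent N N')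
    {k : ℕ} (hk : k ≤ 3) (N : IntegralRep k) (hNd : N.domain = {x | ∀ i, x i ∈ Set.Ioo (0:ℝ) 1})
    (hNr : N.IsRational) (hv : N.value = 0) : of N ∈ relations :=
  boxVanishingDim_mono hk (stub_boxRigidity_var2210_iff_boxVanishing_three.1 h) N hNd hNr hv

/-- **V2210 ⇒ V2204** (level `3` contains level `2`: the square, hence every weight-two Hurwitz sector
unconditionally via `sectorTwo_of_stub_boxRigidity_var2204`). [cite: KontsevichZagier2001, §1.2 Conjecture 1] -/
theorem stub_boxRigidity_var2204_of_var2210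
    (h : ∀ (m' : ℕ) (N : IntegralRep 2) (N' : IntegralRep m'), m' ≤ 3 → N.domain = {x | ∀ i, x i ∈ Set.Ioo (0:ℝ) 1} → N.IsRational → N'.domain = {x | ∀ i, x i ∈ Set.Ioo (0:ℝ) 1} → N'.IsRational → N.value = N'.value → Equivalent N N') :
    ∀ (m' : ℕ) (N : IntegralRep 2) (N' : IntegralRep m'), m' ≤ 2 → N.domain = {x | ∀ i, x i ∈ Set.Ioo (0:ℝ) 1} → N.IsRational → N'.domain = {x | ∀ i, x i ∈ Set.Ioo (0:ℝ) 1} → N'.IsRational → N.value = N'.value → Equivalent N N' :=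
  fun m' N N' hm' => h m' N N' (hm'.trans (by norm_num))

/-- **V2210 ⇒ the Catalan rung unconditionally**: the CONCLUSION of the route item
`CatalanSectorTwoFour` (two representations on the square with integrands `P(xy)/(1 − (xy)⁴)`,
`P'(xy)/(1 − (xy)⁴)` and equal values are KZ-equivalent) without its open hypothesis `Indep_ℚ(1, π², G)`
(through V2204, `catalanSector_unconditional_of_stub_boxRigidity_var2204`). [cite: KontsevichZagier2001, §1.2 Conjecture 1] -/
theorem catalanSector_unconditional_of_stub_boxRigidity_var2210
    (h : ∀ (m' : ℕ) (N : IntegralRep 2) (N' : IntegralRep m'), m' ≤ 3 → N.domain = {x | ∀ i, x i ∈ Set.Ioo (0:ℝ) 1} → N.IsRational → N'.domain = {x | ∀ i, x i ∈ Set.Ioo (0:ℝ) 1} → N'.IsRational → N.value = N'.value → Equivalent N N') :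
    ∀ (r r' : IntegralRep 2) (P P' : Polynomial ℚ), r.domain = {x | ∀ i, x i ∈ Set.Ioo (0:ℝ) 1} →
      r'.domain = {x | ∀ i, x i ∈ Set.Ioo (0:ℝ) 1} →
      EqOn r.integrand (fun x => Polynomial.aeval (x 0 * x 1) P / (1 - (x 0 * x 1) ^ 4)) r.domain →
      EqOn r'.integrand (fun x => Polynomial.aeval (x 0 * x 1) P' / (1 - (x 0 * x 1) ^ 4)) r'.domain →
      r.value = r'.value → Equivalent r r' :=
  catalanSector_unconditional_of_stub_boxRigidity_var2204 (stub_boxRigidity_var2204_of_var2210 h)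

/-- **Parent ⇒ V2210** (the variant is a special case of the leaf `stub_boxRigidity`).
[cite: KontsevichZagier2001, §1.2 Conjecture 1] -/
theorem stub_boxRigidity_var2210_of_parent
    (h : ∀ (m m' : ℕ) (N : IntegralRep m) (N' : IntegralRep m'), N.domain = {x | ∀ i, x i ∈ Set.Ioo (0:ℝ) 1} → N.IsRational → N'.domain = {x | ∀ i, x i ∈ Set.Ioo (0:ℝ) 1} → N'.IsRational → N.value = N'.value → Equivalent N N') :
    ∀ (m' : ℕ) (N : IntegralRep 2) (N' : IntegralRep m'), m' ≤ 3 → N.domain = {x | ∀ i, x i ∈ Set.Ioo (0:ℝ) 1} → N.IsRational → N'.domain = {x | ∀ i, x i ∈ Set.Ioo (0:ℝ) 1} → N'.IsRational → N.value = N'.value → Equivalent N N' :=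
  fun m' N N' _ => h 2 m' N N'

/-- **`KontsevichZagierPeriods ⇒ V2210`**: a refutation of the variant would refute the Summit
(Conjecture 1 for the tree's calculus). [cite: KontsevichZagier2001, §1.2 Conjecture 1] -/
theorem stub_boxRigidity_var2210_of_statement (h : _root_.KontsevichZagierPeriods) :
    ∀ (m' : ℕ) (N : IntegralRep 2) (N' : IntegralRep m'), m' ≤ 3 → N.domain = {x | ∀ i, x i ∈ Set.Ioo (0:ℝ) 1} → N.IsRational → N'.domain = {x | ∀ i, x i ∈ Set.Ioo (0:ℝ) 1} → N'.IsRational → N.value = N'.value → Equivalent N N' :=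
  stub_boxRigidity_var2210_of_parent (leaves_of_statement h).1

end Summit.KontsevichZagierPeriods.KontsevichZagierPeriods.Theorems
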